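import Summits.Schanuel.Schanuel.Theorems.ZilberEacNewtonPolygonStep
import HarnessLib

/-!
# The equimodular class, LXXI: THE NEWTON–PUISEUX THEOREM (existence of an analytic branch) —
# every squarefree `F ∈ ℂ[x][y]` with `F(0, 0) = 0` has a parametrised zero branch `x = t^e`,
# `y = η(t)` through the origin

HONEST FRAMING.  Cell `pub-schanuel` (Zilber's Exponential-Algebraic Closedness, case ladder;
host summit Schanuel), seat 2, gen 26.  **`exists_puiseux_zeroBranch_of_bezout`**: let
`F ∈ ℂ[x][y]` have rows `f_j` with `f_j(0) = 0` for `j < m` and `f_m(0) ≠ 0` (`m ≥ 1`: the point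
`(0, 0)` lies on the curve with `y`-multiplicity `m`), and let `A F + B ∂_yF = r(x) ≠ 0` (no multiple
factor).  Then there are `e ≥ 1` and `η` analytic at `0`, `η(0) = 0`, with `F(t^e, η(t)) = 0` near
`t = 0`.  Proof = Newton's algorithm with a convergence-free ending: induction on `m` (for `m = 1`
the implicit function theorem, file XLIX); for `m ≥ 2` the steepest edge of the Newton polygon
(file LXVIII) and the substitution `x = t^k`, `y = t^μ(w₀ + w)` at a nonzero root `w₀` of the edge
polynomial `E` either LOWER the multiplicity (recursion; the Bézout element is transported by file
LXIX) or — when `E = c(w - w₀)^m`, which forces an integer slope `λ` — the translation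
`y ↦ y + w₀ x^λ` keeps `m` and strictly increases `ord₀ F(x, 0)`, which is bounded by `2·ord₀ r`
(file LXIX); so the process terminates (inner induction), unless `F(x, w₀x^λ) ≡ 0`, an exact
branch.  No formal power series, no Puiseux field.  This is the ingredient that — with the master
theorem of file LXVI — settles Mantova–Masser's question over polynomial graphs (file LXXIII).
[folklore (Newton 1676, Puiseux 1850), made concrete]; nothing here is specific to Schanuel's
conjecture (neither used nor implied); Mantova–Masser's question (PLMS 2024 §1 p. 5) and EC(3,2)
stay OPEN.
-/

noncomputable section

open Filter Topology Polynomial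

set_option linter.dupNamespace false

namespace Summit.Schanuel.Schanuel.Theorems

/-- **Newton–Puiseux: an analytic zero branch through the origin.**  See the module docstring.
[folklore (Newton–Puiseux), made concrete] (new in this form) -/
theorem exists_puiseux_zeroBranch_of_bezout : ∀ (m : ℕ) (F : ℂ[X][X]), 1 ≤ m →
    (∀ j, j < m → (F.coeff j).IsRoot 0) → ¬ (F.coeff m).IsRoot 0 →
    (∃ (A B : ℂ[X][X]) (r : ℂ[X]), r ≠ 0 ∧ A * F + B * derivative F = Polynomial.C r) →
    ∃ (e : ℕ) (η : ℂ → ℂ), 1 ≤ e ∧ AnalyticAt ℂ η 0 ∧ η 0 = 0 ∧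
      ∀ᶠ t in 𝓝 (0 : ℂ), (F.map (Polynomial.evalRingHom (t ^ e))).eval (η t) = 0 := by
  classical
  intro m
  induction m using Nat.strong_induction_on with
  | _ m ihm =>
  intro F hm hlow htop hbez
  by_cases hm1 : m = 1
  · /- a simple root: the implicit function theorem -/
    subst hm1
    have hroot : (F.map (Polynomial.evalRingHom 0)).IsRoot 0 := by
      rw [Polynomial.IsRoot, ← Polynomial.coeff_zero_eq_eval_zero, Polynomial.coeff_map,
        Polynomial.coe_evalRingHom]
      exact hlow 0 zero_lt_one
    have hsimple : ¬ ((derivative F).map (Polynomial.evalRingHom 0)).IsRoot 0 := by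
      rw [Polynomial.IsRoot, ← Polynomial.coeff_zero_eq_eval_zero, Polynomial.coeff_map,
        Polynomial.coeff_derivative, Polynomial.coe_evalRingHom, zero_add, Nat.cast_zero, zero_add, mul_one]
      exact htop
    obtain ⟨η, hηan, hη0, hηroot⟩ := exists_branchAt F hroot hsimple
    refine ⟨1, η, le_rfl, hηan, hη0, ?_⟩
    filter_upwards [hηroot] with t ht
    rwa [pow_one]
  have hm2 : 2 ≤ m := by omega
  obtain ⟨A, B, r, hr, hAB⟩ := hbez
  /- inner induction on `n ≥ 2·ord₀ r + 1 - ord₀ f₀` -/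
  suffices key : ∀ (n : ℕ) (F A B : ℂ[X][X]),
      2 * Polynomial.rootMultiplicity 0 r + 1 - Polynomial.rootMultiplicity 0 (F.coeff 0) ≤ n →
      (∀ j, j < m → (F.coeff j).IsRoot 0) → ¬ (F.coeff m).IsRoot 0 →
      A * F + B * derivative F = Polynomial.C r →
      ∃ (e : ℕ) (η : ℂ → ℂ), 1 ≤ e ∧ AnalyticAt ℂ η 0 ∧ η 0 = 0 ∧
        ∀ᶠ t in 𝓝 (0 : ℂ), (F.map (Polynomial.evalRingHom (t ^ e))).eval (η t) = 0 from
    key _ F A B le_rfl hlow htop hAB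
  intro n
  induction n using Nat.strong_induction_on with
  | _ n ihn =>
  intro F A B hn hlow htop hAB
  -- some row below `m` is nonzero (squarefreeness)
  have hex : ∃ j, j < m ∧ F.coeff j ≠ 0 := by
    by_contra hall
    push Not at hall
    apply hr
    have h := congrArg (fun P : ℂ[X][X] => P.coeff 0) hAB
    simp only [Polynomial.coeff_add, Polynomial.mul_coeff_zero, Polynomial.coeff_derivative,
      Polynomial.coeff_C_zero, zero_add, Nat.cast_zero, mul_one] at h
    rw [hall 0 (by omega), hall 1 (by omega), mul_zero, mul_zero, add_zero] at h
    exact h.symm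
  -- the first edge and its polynomial
  obtain ⟨k, μ, hk, hμ, hedge, j₁, hj₁m, hj₁0, hj₁⟩ := exists_firstEdge F hlow hex
  obtain ⟨hEm, hEgt, hEj₁, hEdeg, hE0⟩ := firstEdge_poly F hμ htop hj₁0 hj₁
  obtain ⟨G, hG0, hid⟩ := exists_newtonDatum_edge_eq F 0 hk hedge
  set E : Polynomial ℂ := ∑ i ∈ (Finset.range (F.natDegree + 1)).filter (fun i => F.coeff i ≠ 0 ∧
      k * Polynomial.rootMultiplicity 0 (F.coeff i) + μ * i = μ * m),
      Polynomial.C ((F.coeff i /ₘ (Polynomial.X - Polynomial.C 0) ^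
        Polynomial.rootMultiplicity 0 (F.coeff i)).eval 0) * Polynomial.X ^ i with hEdef
  -- a nonzero root `w₀` of `E`, of multiplicity `m₁ ≤ m`
  obtain ⟨w₀, hw₀0, hEw₀, hm₁1, hm₁m⟩ := exists_root_firstEdge hE0 hEdeg hj₁m hEj₁
  rcases lt_or_eq_of_le hm₁m with hlt | heq
  · /- (A) the multiplicity drops: recursion on `G̃(t, w) = G(t, w₀ + w)` -/
    obtain ⟨hlow', htop'⟩ := recentre_facts hG0 hE0 w₀
    obtain ⟨A₁, B₁, r₁, hr₁, hbez₁⟩ := exists_bezout_of_newtonDatum hr hAB hk hid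
    have hbez₂ := bezout_comp_X_add_C hbez₁ (Polynomial.C w₀)
    obtain ⟨e', η', he', hη'an, hη'0, hroot'⟩ :=
      ihm _ hlt _ hm₁1 hlow' htop' ⟨_, _, r₁, hr₁, hbez₂⟩
    refine ⟨e' * k, fun τ => (τ ^ e') ^ μ * (η' τ + w₀), Nat.mul_pos he' hk,
      ((analyticAt_id.pow e').pow μ).mul (hη'an.add analyticAt_const), ?_, ?_⟩
    · simp [hη'0, zero_pow (by omega : e' ≠ 0), zero_pow (by omega : μ ≠ 0)]
    · filter_upwards [hroot'] with τ hτ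
      rw [evalPP_comp_X_add_C, Polynomial.eval_C] at hτ
      have h := hid (τ ^ e') (η' τ + w₀)
      rw [zero_add, hτ, mul_zero] at h
      rw [pow_mul]
      exact h
  · /- (B) the totally degenerate edge: integer slope, translation -/
    obtain ⟨hEm1, hE0c⟩ := coeff_ne_zero_of_rootMultiplicity_eq_natDegree hE0 hEdeg (by omega) hw₀0 heq
    obtain ⟨hμk, hf0, ho0, hedge₁, hE₁eq⟩ := degenerate_edge F hk (by omega) hedge hEm1 hE0c
    set lam := Polynomial.rootMultiplicity 0 (F.coeff (m - 1)) with hlamdef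
    have hlam : 1 ≤ lam := by
      rcases Nat.eq_zero_or_pos lam with h | h
      · rw [h, mul_zero] at hμk; omega
      · exact h
    obtain ⟨G₁, hG₁0, hid₁⟩ := exists_newtonDatum_edge_eq F 0 le_rfl hedge₁
    rw [hE₁eq] at hG₁0
    -- the bound `λ(m-1) ≤ ord₀ r`
    have hbound := mul_le_rootMultiplicity_of_newtonDatum hr hAB hm hid₁
    -- the translated polynomial
    obtain ⟨hrows, hevF₁, hf₀new⟩ := translate_facts F w₀ hlam
    set F₁ := F.comp (Polynomial.X + Polynomial.C (Polynomial.C w₀ * Polynomial.X ^ lam)) with hF₁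
    have hbezF₁ := bezout_comp_X_add_C hAB (Polynomial.C w₀ * Polynomial.X ^ lam)
    have hlow₁ : ∀ j, j < m → (F₁.coeff j).IsRoot 0 := fun j hj => by
      rw [Polynomial.IsRoot, hrows]; exact hlow j hj
    have htop₁ : ¬ (F₁.coeff m).IsRoot 0 := by
      rw [Polynomial.IsRoot, hrows]; exact htop
    -- `F₁(t, 0) = F(t, w₀ t^λ) = t^{λ m} g(t)` with `g(0) = E(w₀) = 0`
    set g : ℂ[X] := G₁.eval (Polynomial.C w₀) with hg
    have hg0 : g.eval 0 = 0 := by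
      rw [hg, eval_eval_eq_evalPP, Polynomial.eval_C, hG₁0]
      exact hEw₀
    have hf₀eval : ∀ t : ℂ, (F₁.coeff 0).eval t = (Polynomial.X ^ (lam * m) * g).eval t := by
      intro t
      rw [hf₀new, Polynomial.eval_mul, Polynomial.eval_pow, Polynomial.eval_X, hg, eval_eval_eq_evalPP,
        Polynomial.eval_C]
      have h := hid₁ t w₀
      rw [pow_one, zero_add, mul_comm (t ^ lam) w₀] at h
      exact h
    have hf₀eq : F₁.coeff 0 = Polynomial.X ^ (lam * m) * g := Polynomial.funext hf₀eval
    by_cases hzero : F₁.coeff 0 = 0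
    · /- `F(t, w₀ t^λ) ≡ 0`: an exact branch -/
      refine ⟨1, fun t => w₀ * t ^ lam, le_rfl, analyticAt_const.mul (analyticAt_id.pow lam),
        by simp [zero_pow (by omega : lam ≠ 0)], Eventually.of_forall fun t => ?_⟩
      rw [pow_one, ← hf₀new, hzero, Polynomial.eval_zero]
    · /- the measure decreases: inner induction -/
      have hgX : Polynomial.X ∣ g := by
        rw [Polynomial.X_dvd_iff, Polynomial.coeff_zero_eq_eval_zero]; exact hg0
      obtain ⟨g', hg'⟩ := hgX
      have hord : lam * m + 1 ≤ Polynomial.rootMultiplicity 0 (F₁.coeff 0) := by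
        rw [Polynomial.le_rootMultiplicity_iff hzero, map_zero, sub_zero]
        exact ⟨g', by rw [hf₀eq, hg', pow_succ]; ring⟩
      have h2 : lam * m ≤ 2 * Polynomial.rootMultiplicity 0 r := by
        obtain ⟨m', rfl⟩ : ∃ m', m = m' + 2 := ⟨m - 2, by omega⟩
        have e1 : lam * (m' + 2 - 1) = lam * m' + lam := by
          rw [show m' + 2 - 1 = m' + 1 by omega]; ring
        rw [e1] at hbound
        nlinarith
      have hn' : 2 * Polynomial.rootMultiplicity 0 r + 1 - Polynomial.rootMultiplicity 0 (F₁.coeff 0) < n := by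
        rw [ho0] at hn
        omega
      obtain ⟨e, η₁, he, hη₁an, hη₁0, hroot₁⟩ :=
        ihn _ hn' F₁ _ _ le_rfl hlow₁ htop₁ hbezF₁
      refine ⟨e, fun t => η₁ t + w₀ * (t ^ e) ^ lam, he,
        hη₁an.add (analyticAt_const.mul ((analyticAt_id.pow e).pow lam)), ?_, ?_⟩
      · simp [hη₁0, zero_pow (by omega : e ≠ 0), zero_pow (by omega : lam ≠ 0)]
      · filter_upwards [hroot₁] with t ht
        rw [hevF₁] at ht
        exact ht

end Summit.Schanuel.Schanuel.Theorems
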